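import Summits.CriticalPhenomena.PercolationContinuityZ3.Theorems.Transplant.KNCells2CorridorO
import Summits.CriticalPhenomena.PercolationContinuityZ3.Theorems.Transplant.KNCells2Corridor
import Summits.CriticalPhenomena.PercolationContinuityZ3.Theorems.Transplant.KNLevelsTargetChainEdge
import Summits.CriticalPhenomena.PercolationContinuityZ3.Theorems.Transplant.KNCellsSchemeO
import Summits.CriticalPhenomena.PercolationContinuityZ3.Theorems.Transplant.KNCellsProcessO
import Summits.CriticalPhenomena.PercolationContinuityZ3.Theorems.Transplant.KNCells2SchemeO
import Summits.CriticalPhenomena.PercolationContinuityZ3.Theorems.Transplant.KNCellsStepsDefsO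
import Summits.CriticalPhenomena.PercolationContinuityZ3.Theorems.Transplant.KNCellsStepsReachO
import Summits.CriticalPhenomena.PercolationContinuityZ3.Theorems.Transplant.KNCellsStepsPinO
import Summits.CriticalPhenomena.PercolationContinuityZ3.Theorems.Transplant.KNCellsStepsSubboxO
import Summits.CriticalPhenomena.PercolationContinuityZ3.Theorems.Transplant.KNCells2CorridorEdge
import Literature.Probability.Percolation.OrientedHistorySiteRenormalizationRun
import HarnessLib

/-!
# N2 (frames-only node `SamePDropOfSkeletonFrm₁`, OPEN) — ORIENTED MACRO LAYER (WAVE 0 (c1), (R-18) `q ≡ true`): the oriented twin of N1's `KNCells2CorridorEdge`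

builds on p205010 (kernel theorem, internal audit signed; external expert review pending) — nothing in this file uses p205010; NOTHING is claimed about the
open node `SamePDropOfSkeletonFrm₁` (`SamePDropOfSkeletonNeg₁` is CLOSED in the tree and untouched by this file).
Status sentence (coordinator 2026-08-20T04:30Z): "θ(p_c) = 0 on ℤ^d, all d ≥ 2 — kernel-verified (Lean 4/Mathlib, standard axioms); internal adversarial
audit SIGNED 2026-08-20 04:29Z; external expert review pending."
Lane `prim-bschramm-*`, seat `prim-bschramm-stmt` (gen 19); helper file (`--supports stmt-CriticalPhenomena-4575 --as helper`); N2-SCOPE §20, (R-18)/(R-19).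
PORT RULES (HOME/prim-bschramm-stmt-g19/lean/port_orient.py): the history-site API is replaced by its ORIENTED twin at the fixed quadrant `qNE := fun _ => true`
(`HState.choice ↦ HState.ochoice qNE`, `mstOf ↦ omstOf qNE`, `mst/stN ↦ omst/ostN qNE`, `occFinal ↦ ooccFinal qNE`, `Lawful ↦ OLawful qNE`, onward directions
`onward ↦ onwardO` = the POSITIVE ones, (N2-e)); every declaration whose text changes thereby — directly or through a changed declaration — is re-declared with the
suffix `O` (same namespace); unchanged declarations of the N1 file are NOT repeated (the N1 module is imported). Docstrings/citations are N1's.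
N1 HEADER (kept for the reader):
* **`hreach_of_chain_edge`** — after a valid history, at the history anchors and an onward direction: a chain of `n + 1` target steps over
  any locally finite graph structure `G'` on the vertices, with source `root`, enlarged targets `(s i).T ⊇ T' i`, true targets linked into the
  next cores, kits at the accuracy `δ` of `TargetProperty.chain_edge` under the corridor weighting `Wcor`, excess `≤ η ≤ δ/2`, first core
  `⊇ M^α_x`, last true target `M^β_{x+du}`, and `δc ≤ δ` ⟹ `1 - ε'' < P_μ(Reach h e α β du)`;
* `hreach_of_chain_edge_sub` — the same with the last true target any part of `M^β_{x+du}` (the chain lives inside `U`, the cube need not).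
[cite: KozmaNitzan2024, §4 Lemma 12 (pp. 23–25), p. 30 (Step IV) — the ℤ^d model] [cite: GrimmettPercolation1999, §7.2]
-/
noncomputable section

open MeasureTheory ProbabilityTheory
open scoped ENNReal Classical

namespace Summit.CriticalPhenomena.PercolationContinuityZ3.Theorems

namespace Transplant

namespace KNCells

open Literature.Probability.Percolation Literature.Probability.LatticeModels SimpleGraph GadgetSystem ProbeHistory HSiteScheme Contour

variable {V : Type*} [DecidableEq V] [Countable V]

namespace KSchA

variable {A : Type*} {G : SimpleGraph V} [G.LocallyFinite] {S : KSchA V A} {FD : FaceData V A}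
variable {h : ProbeHistory V} {e : Site 2 × MDir} {a' : A} {du : MDir}

/-- **LEMMA 12 OVER CELLS WITH ENLARGED TARGETS ⟹ `hreach`.** [cite: KozmaNitzan2024, §4 Lemma 12 (pp. 23–25), p. 30 (Step IV)] -/
theorem hreach_of_chain_edgeO (G' : SimpleGraph V) [G'.LocallyFinite] (hV : S.Valid₂O G h e) {Δ' : ℕ} {δ ε'' η : ℝ} {n : ℕ}
    (hδc : S.δc ≤ δ)
    (hchain : ∀ (W : Sym2 V → unitInterval) (s : Fin (n + 1) → KNLevels.TStep G') (T' : Fin (n + 1) → Finset V) (η : ℝ),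
      (∀ i : Fin (n + 1), (s i).L.o = (s 0).L.o) →
      (∀ i : Fin n, T' (Fin.castSucc i) ⊆ (s i.succ).L.X 0) →
      (∀ i : Fin (n + 1), T' i ⊆ (s i).T) →
      (∀ i : Fin (n + 1), (s i).KitsAt W S.p Δ' δ) →
      η ≤ δ / 2 →
      (∀ i : Fin (n + 1), (prodBernoulli W).real (⋃ t ∈ (s i).T \ T' i, openConn (s 0).L.o t) ≤ η) →
      1 - δ < (prodBernoulli W).real (s 0).L.reachB →
        1 - ε'' < (prodBernoulli W).real (⋃ t ∈ T' (Fin.last n), openConn (s 0).L.o t))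
    (s : Fin (n + 1) → KNLevels.TStep G') (T' : Fin (n + 1) → Finset V) (ho : ∀ i : Fin (n + 1), (s i).L.o = S.Γ.root)
    (hlink : ∀ i : Fin n, T' (Fin.castSucc i) ⊆ (s i.succ).L.X 0) (hsub : ∀ i : Fin (n + 1), T' i ⊆ (s i).T)
    (hkits : ∀ i : Fin (n + 1), (s i).KitsAt (S.Wcor G FD h e (S.aOf₁O G h e) a' du) S.p Δ' δ) (hη : η ≤ δ / 2)
    (hexc : ∀ i : Fin (n + 1), (prodBernoulli (S.Wcor G FD h e (S.aOf₁O G h e) a' du)).real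
      (⋃ t ∈ (s i).T \ T' i, openConn S.Γ.root t) ≤ η)
    (hB0 : S.Γ.M (S.aOf₁O G h e) (tgt e) ⊆ (s 0).L.X 0) (hTn : T' (Fin.last n) = S.Γ.M a' (tgt e + stepVec du)) :
    1 - ε'' < (prodBernoulli (S.Wfull G h e (S.aOf₁O G h e) a' du)).real (S.Reach G FD h e (S.aOf₁O G h e) a' du) := by
  set α := S.aOf₁O G h e with hα
  have hroot : S.Γ.root ∈ S.Ucor G FD h e α a' du := Finset.mem_union_left _ (Finset.mem_union_left _ hV.root_mem)
  have ho' : ∀ i : Fin (n + 1), (s i).L.o = (s 0).L.o := fun i => by rw [ho i, ho 0]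
  have hsrc : 1 - δ < (prodBernoulli (S.Wcor G FD h e α a' du)).real (s 0).L.reachB := by
    have := lt_real_reachB_WcorO hV hroot hB0 (a' := a') (du := du)
    rw [KNLevels.LData.reachB, ho 0]
    linarith
  have hexc' : ∀ i : Fin (n + 1), (prodBernoulli (S.Wcor G FD h e α a' du)).real
      (⋃ t ∈ (s i).T \ T' i, openConn (s 0).L.o t) ≤ η := fun i => by rw [ho 0]; exact hexc i
  have hc := hchain _ s T' η ho' hlink hsub hkits hη hexc' hsrc
  rw [hTn, ho 0, Wcor, ← Finset.set_biUnion_coe, prodBernoulli_restrW_real_biUnion_openConn _ _ (Finset.mem_coe.2 hroot)] at hc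
  exact hc

/-- **`hreach_of_chain_edgeO` with the last true target any nonempty part of `M^β_{x+du}`** (e.g. `M_y ∩ H_{x,y}`: reaching a part of the cube
reaches the cube). [cite: KozmaNitzan2024, §4 Lemma 12 (pp. 23–25), p. 30 (Step IV)] -/
theorem hreach_of_chain_edge_subO (G' : SimpleGraph V) [G'.LocallyFinite] (hV : S.Valid₂O G h e) {Δ' : ℕ} {δ ε'' η : ℝ} {n : ℕ}
    (hδc : S.δc ≤ δ)
    (hchain : ∀ (W : Sym2 V → unitInterval) (s : Fin (n + 1) → KNLevels.TStep G') (T' : Fin (n + 1) → Finset V) (η : ℝ),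
      (∀ i : Fin (n + 1), (s i).L.o = (s 0).L.o) →
      (∀ i : Fin n, T' (Fin.castSucc i) ⊆ (s i.succ).L.X 0) →
      (∀ i : Fin (n + 1), T' i ⊆ (s i).T) →
      (∀ i : Fin (n + 1), (s i).KitsAt W S.p Δ' δ) →
      η ≤ δ / 2 →
      (∀ i : Fin (n + 1), (prodBernoulli W).real (⋃ t ∈ (s i).T \ T' i, openConn (s 0).L.o t) ≤ η) →
      1 - δ < (prodBernoulli W).real (s 0).L.reachB →
        1 - ε'' < (prodBernoulli W).real (⋃ t ∈ T' (Fin.last n), openConn (s 0).L.o t))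
    (s : Fin (n + 1) → KNLevels.TStep G') (T' : Fin (n + 1) → Finset V) (ho : ∀ i : Fin (n + 1), (s i).L.o = S.Γ.root)
    (hlink : ∀ i : Fin n, T' (Fin.castSucc i) ⊆ (s i.succ).L.X 0) (hsub : ∀ i : Fin (n + 1), T' i ⊆ (s i).T)
    (hkits : ∀ i : Fin (n + 1), (s i).KitsAt (S.Wcor G FD h e (S.aOf₁O G h e) a' du) S.p Δ' δ) (hη : η ≤ δ / 2)
    (hexc : ∀ i : Fin (n + 1), (prodBernoulli (S.Wcor G FD h e (S.aOf₁O G h e) a' du)).real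
      (⋃ t ∈ (s i).T \ T' i, openConn S.Γ.root t) ≤ η)
    (hB0 : S.Γ.M (S.aOf₁O G h e) (tgt e) ⊆ (s 0).L.X 0) (hTn : T' (Fin.last n) ⊆ S.Γ.M a' (tgt e + stepVec du)) :
    1 - ε'' < (prodBernoulli (S.Wfull G h e (S.aOf₁O G h e) a' du)).real (S.Reach G FD h e (S.aOf₁O G h e) a' du) := by
  set α := S.aOf₁O G h e with hα
  have hroot : S.Γ.root ∈ S.Ucor G FD h e α a' du := Finset.mem_union_left _ (Finset.mem_union_left _ hV.root_mem)
  have ho' : ∀ i : Fin (n + 1), (s i).L.o = (s 0).L.o := fun i => by rw [ho i, ho 0]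
  have hsrc : 1 - δ < (prodBernoulli (S.Wcor G FD h e α a' du)).real (s 0).L.reachB := by
    have := lt_real_reachB_WcorO hV hroot hB0 (a' := a') (du := du)
    rw [KNLevels.LData.reachB, ho 0]
    linarith
  have hexc' : ∀ i : Fin (n + 1), (prodBernoulli (S.Wcor G FD h e α a' du)).real
      (⋃ t ∈ (s i).T \ T' i, openConn (s 0).L.o t) ≤ η := fun i => by rw [ho 0]; exact hexc i
  have hc := hchain _ s T' η ho' hlink hsub hkits hη hexc' hsrc
  rw [ho 0, Wcor, ← Finset.set_biUnion_coe, prodBernoulli_restrW_real_biUnion_openConn _ _ (Finset.mem_coe.2 hroot)] at hc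
  refine hc.trans_le (measureReal_mono ?_ (measure_ne_top _ _))
  rw [Reach, Ucor]
  exact biUnion_openConnIn_mono subset_rfl _ (Finset.coe_subset.2 hTn)

end KSchA

end KNCells

end Transplant

end Summit.CriticalPhenomena.PercolationContinuityZ3.Theorems

end
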